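import Mathlib
import HarnessLib
import Summits.AtomisticToContinuum.FouriersLaw.Statement
import Summits.AtomisticToContinuum.FouriersLaw.Theses.ContactStieltjesMeasure

/-!
# Birth skeleton (BC3) for crux `ContactMeasureLimit` — stmt-AtomisticToContinuum-15250

Route `route-AtomisticToContinuum-ContactStieltjesMeasure` (sub-problem `FouriersLaw`), crux (M):
for every family `Φ_N` of contact distribution functions representing the two-terminal response of
`pinnedChain ω₂ lam β ·` at temperature `T` and EVERY friction `γ` (the data of K2), the scaled
contact distribution functions `N·Φ_N` converge at every continuity point `t > 0` of a monotone `M`.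

The line is the route header's own two-layer plan `(M) ⇐ StieltjesCauchy → VagueIdentification`:

* `stub_stieltjesCauchy` (physics, the open part): for every representing family and every friction
  `γ > 0` the scaled contact Stieltjes transforms `N·Ĝ_N(γ) := N·∫₀^∞ Φ_N(t)·2t/(γ²+t²)² dt` converge as
  `N → ∞`.  Through K2, `N·Ĝ_N(γ) = N·D_N(γ)/((N-1)γ)`, so this is exactly "the linear-response
  coefficient `D_N(γ)` has a limit at every bath coupling `γ`" — the existence clause of Fourier's law,
  coupling by coupling, with no positivity and no identification of the limit.
* `stub_stieltjesContinuity` (real analysis, a continuity theorem for the contact kernel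
  `k_γ(t) = 2t/(γ²+t²)²`, i.e. for Stieltjes transforms `∫ dμ(s)/(γ²+s²)` known on `γ > 0` only):
  if `F_N` are monotone, vanish on `(-∞,0]`, are bounded (so the integrals are honest Bochner
  integrals) and `∫₀^∞ F_N k_γ` converges for every `γ > 0`, then `F_N → M` at the continuity points of
  a monotone `M`.  Proof sketch: `F_N(t) ≤ (γ²+t²)·sup_N ∫F_N k_γ` (a priori local bound from ONE
  friction, since `∫_t^∞ k_γ = 1/(γ²+t²)`) ⇒ Helly selection; for a subsequential limit `M₀` the escaped
  mass `e := lim_R lim_k ∫_R^∞ F_(N_k) k_γ` is `γ`-independent (`k_γ/k_γ' → 1` at infinity) and equals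
  `lim_(γ→∞) lim_N ∫F_N k_γ`, so two subsequential limits have `∫ dμ₀/(γ²+s²) = ∫ dμ₁/(γ²+s²)` for all
  `γ > 0`; Stone–Weierstrass on `[0,∞]` for the algebra spanned by `1, (z+s²)⁻¹` (closed under products
  by partial fractions) gives `μ₀ = μ₁`; sub-subsequence argument at continuity points.
* `tendsto_scaled_of_transforms` (PROVED glue): the continuity theorem applied to the truncated
  rescaled family `scaledFamily Φ` (`N·Φ_N` for `N ≥ 2`, `0` for `N < 2`), moving the factor `N` inside
  the integral and transferring both limits along the eventual equalities.
* `ContactMeasureLimit_of` (PROVED from the two stubs BY NAME, A12 shape: concludes the crux decl by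
  name, no hypotheses, `sorry` only inside `stub_*`); the `example` right after it is the same
  composition with the stub statements as explicit hypotheses (`stub₁-sig → stub₂-sig → crux`).

Honesty w.r.t. the crux: `stub_stieltjesCauchy` is NOT the crux reworded — it speaks of transforms
(conductances), not of distribution functions; crux ⇒ stub needs the upper density (U) (dominated
convergence), stub ⇒ crux needs the continuity theorem.  Neither stub mentions NESS positivity or
uniqueness, so neither reaches `FouriersLaw` (BC3 probes `stub → crux`, `stub → FouriersLaw` by
`first | exact? | simpa | aesop` all fail: folder `bc/probe_*.lean`).
-/

namespace Summit.AtomisticToContinuum.FouriersLaw.Cruxes.ContactMeasureLimit.Birth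

open Filter MeasureTheory Set

/-- stub 1 — STIELTJES–CAUCHY (the physical content; route two-layer plan `StieltjesCauchy`).
For `pinnedChain ω₂ lam β ·` (all `> 0`), `T > 0` and every family `Φ` satisfying the crux's
representing hypothesis verbatim, for every friction `γ > 0` the sequence
`N ↦ N · ∫_(t>0) Φ_N(t) · 2t/(γ²+t²)² dt` (`= N·D_N(γ)/((N-1)γ)` by the representation) converges. -/
theorem stub_stieltjesCauchy :
    ∀ ω₂ lam β : ℝ, 0 < ω₂ → 0 < lam → 0 < β → ∀ T : ℝ, 0 < T → ∀ Φ : ℕ → ℝ → ℝ,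
      (∀ N : ℕ, 2 ≤ N → Monotone (Φ N) ∧ (∀ s : ℝ, s ≤ 0 → Φ N s = 0) ∧ (∃ m : ℝ, ∀ s : ℝ, Φ N s ≤ m) ∧
        ∀ γ : ℝ, 0 < γ →
          (∀ (N' : ℕ) (T_L T_R : ℝ), 0 < T_L → 0 < T_R →
            ∀ μ ν : MeasureTheory.Measure (Literature.MathematicalPhysics.KineticTheory.HeatConduction.PhaseSpace N'),
              (Literature.MathematicalPhysics.KineticTheory.HeatConduction.pinnedChain ω₂ lam β γ).IsSteadyState N' T_L T_R μ →
              (Literature.MathematicalPhysics.KineticTheory.HeatConduction.pinnedChain ω₂ lam β γ).IsSteadyState N' T_L T_R ν → μ = ν) →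
          ∀ μ : (N' : ℕ) → ℝ → ℝ → MeasureTheory.Measure (Literature.MathematicalPhysics.KineticTheory.HeatConduction.PhaseSpace N'),
            (∀ (N' : ℕ) (T_L T_R : ℝ), 0 < T_L → 0 < T_R →
              (Literature.MathematicalPhysics.KineticTheory.HeatConduction.pinnedChain ω₂ lam β γ).IsSteadyState N' T_L T_R (μ N' T_L T_R)) →
            Filter.Tendsto (fun δ : ℝ =>
              (Literature.MathematicalPhysics.KineticTheory.HeatConduction.pinnedChain ω₂ lam β γ).totalCurrent
                (μ N (T + δ / 2) (T - δ / 2)) / δ) (nhdsWithin 0 {(0 : ℝ)}ᶜ)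
              (nhds (((N : ℝ) - 1) * γ * ∫ t in Set.Ioi (0 : ℝ), Φ N t * (2 * t / (γ ^ 2 + t ^ 2) ^ 2)))) →
      ∀ γ : ℝ, 0 < γ → ∃ L : ℝ,
        Filter.Tendsto (fun N : ℕ => (N : ℝ) * ∫ t in Set.Ioi (0 : ℝ), Φ N t * (2 * t / (γ ^ 2 + t ^ 2) ^ 2))
          Filter.atTop (nhds L) := by
  sorry

/-- stub 2 — STIELTJES CONTINUITY THEOREM for the contact kernel (route two-layer plan
`VagueIdentification`; pure real analysis).  Monotone `F_N` vanishing on `(-∞,0]`, each bounded, whose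
contact transforms `∫_(t>0) F_N(t)·2t/(γ²+t²)² dt` converge for every `γ > 0`, converge themselves at
every continuity point `t > 0` of some monotone `M`.  (A priori bound from one friction, Helly selection,
escaped mass is `γ`-independent, uniqueness of `∫dμ(s)/(γ²+s²)` on `γ > 0` by Stone–Weierstrass.) -/
theorem stub_stieltjesContinuity :
    ∀ F : ℕ → ℝ → ℝ,
      (∀ N : ℕ, Monotone (F N) ∧ (∀ s : ℝ, s ≤ 0 → F N s = 0) ∧ (∃ m : ℝ, ∀ s : ℝ, F N s ≤ m)) →
      (∀ γ : ℝ, 0 < γ → ∃ L : ℝ,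
        Filter.Tendsto (fun N : ℕ => ∫ t in Set.Ioi (0 : ℝ), F N t * (2 * t / (γ ^ 2 + t ^ 2) ^ 2))
          Filter.atTop (nhds L)) →
      ∃ M : ℝ → ℝ, Monotone M ∧ ∀ t : ℝ, 0 < t → ContinuousAt M t →
        Filter.Tendsto (fun N : ℕ => F N t) Filter.atTop (nhds (M t)) := by
  sorry

/-- Bookkeeping for the assembly: the rescaled family `N·Φ_N`, truncated to `0` below `N = 2`
(where the crux's hypothesis says nothing about `Φ_N`). -/
noncomputable def scaledFamily (Φ : ℕ → ℝ → ℝ) (N : ℕ) (t : ℝ) : ℝ :=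
  if 2 ≤ N then (N : ℝ) * Φ N t else 0

theorem scaledFamily_of_le {Φ : ℕ → ℝ → ℝ} {N : ℕ} (hN : 2 ≤ N) (t : ℝ) :
    scaledFamily Φ N t = (N : ℝ) * Φ N t := if_pos hN

theorem scaledFamily_of_not_le {Φ : ℕ → ℝ → ℝ} {N : ℕ} (hN : ¬ 2 ≤ N) (t : ℝ) :
    scaledFamily Φ N t = 0 := if_neg hN

/-- GLUE (proved, sorry-free): the continuity theorem (as a hypothesis `hS`, = the statement of
`stub_stieltjesContinuity`) transports per-friction convergence of the scaled transforms
`N·∫ Φ_N k_γ` of a family that is monotone / vanishing on `(-∞,0]` / bounded from `N = 2` on, to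
convergence of `N·Φ_N(t)` at the continuity points of a monotone `M`. -/
theorem tendsto_scaled_of_transforms
    (hS : ∀ F : ℕ → ℝ → ℝ,
      (∀ N : ℕ, Monotone (F N) ∧ (∀ s : ℝ, s ≤ 0 → F N s = 0) ∧ (∃ m : ℝ, ∀ s : ℝ, F N s ≤ m)) →
      (∀ γ : ℝ, 0 < γ → ∃ L : ℝ,
        Filter.Tendsto (fun N : ℕ => ∫ t in Set.Ioi (0 : ℝ), F N t * (2 * t / (γ ^ 2 + t ^ 2) ^ 2))
          Filter.atTop (nhds L)) →
      ∃ M : ℝ → ℝ, Monotone M ∧ ∀ t : ℝ, 0 < t → ContinuousAt M t →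
        Filter.Tendsto (fun N : ℕ => F N t) Filter.atTop (nhds (M t)))
    (Φ : ℕ → ℝ → ℝ)
    (hΦ : ∀ N : ℕ, 2 ≤ N → Monotone (Φ N) ∧ (∀ s : ℝ, s ≤ 0 → Φ N s = 0) ∧ (∃ m : ℝ, ∀ s : ℝ, Φ N s ≤ m))
    (hC : ∀ γ : ℝ, 0 < γ → ∃ L : ℝ,
      Filter.Tendsto (fun N : ℕ => (N : ℝ) * ∫ t in Set.Ioi (0 : ℝ), Φ N t * (2 * t / (γ ^ 2 + t ^ 2) ^ 2))
        Filter.atTop (nhds L)) :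
    ∃ M : ℝ → ℝ, Monotone M ∧ ∀ t : ℝ, 0 < t → ContinuousAt M t →
      Filter.Tendsto (fun N : ℕ => (N : ℝ) * Φ N t) Filter.atTop (nhds (M t)) := by
  -- (1) the truncated rescaled family satisfies the hypotheses of the continuity theorem for ALL N
  have h1 : ∀ N : ℕ, Monotone (scaledFamily Φ N) ∧ (∀ s : ℝ, s ≤ 0 → scaledFamily Φ N s = 0) ∧
      (∃ m : ℝ, ∀ s : ℝ, scaledFamily Φ N s ≤ m) := by
    intro N
    by_cases hN : 2 ≤ N
    · obtain ⟨hmono, hzero, ⟨m, hm⟩⟩ := hΦ N hN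
      have hN0 : (0 : ℝ) ≤ (N : ℝ) := Nat.cast_nonneg N
      refine ⟨fun a b hab => ?_, fun s hs => ?_, ⟨(N : ℝ) * m, fun s => ?_⟩⟩
      · rw [scaledFamily_of_le hN, scaledFamily_of_le hN]
        exact mul_le_mul_of_nonneg_left (hmono hab) hN0
      · rw [scaledFamily_of_le hN, hzero s hs, mul_zero]
      · rw [scaledFamily_of_le hN]
        exact mul_le_mul_of_nonneg_left (hm s) hN0
    · refine ⟨fun a b _ => ?_, fun s _ => scaledFamily_of_not_le hN s, ⟨0, fun s => ?_⟩⟩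
      · rw [scaledFamily_of_not_le hN, scaledFamily_of_not_le hN]
      · rw [scaledFamily_of_not_le hN]
  -- (2) its contact transforms converge for every friction: move `N` inside the integral
  have h2 : ∀ γ : ℝ, 0 < γ → ∃ L : ℝ, Filter.Tendsto
      (fun N : ℕ => ∫ t in Set.Ioi (0 : ℝ), scaledFamily Φ N t * (2 * t / (γ ^ 2 + t ^ 2) ^ 2))
      Filter.atTop (nhds L) := by
    intro γ hγ
    obtain ⟨L, hL⟩ := hC γ hγ
    refine ⟨L, hL.congr' ?_⟩
    filter_upwards [Filter.eventually_ge_atTop 2] with N hN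
    have hfun : (fun t : ℝ => scaledFamily Φ N t * (2 * t / (γ ^ 2 + t ^ 2) ^ 2)) =
        fun t : ℝ => (N : ℝ) * (Φ N t * (2 * t / (γ ^ 2 + t ^ 2) ^ 2)) := by
      funext t
      rw [scaledFamily_of_le hN, mul_assoc]
    rw [hfun, MeasureTheory.integral_const_mul]
  -- (3) the continuity theorem, transferred back to `N·Φ_N` along the eventual equality
  obtain ⟨M, hMmono, hM⟩ := hS (scaledFamily Φ) h1 h2
  refine ⟨M, hMmono, fun t ht hct => ?_⟩
  refine (hM t ht hct).congr' ?_
  filter_upwards [Filter.eventually_ge_atTop 2] with N hN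
  exact scaledFamily_of_le hN t

/-- ASSEMBLY (A12 skeleton shape): the crux `ContactMeasureLimit`, concluded BY NAME, from the two
stubs BY NAME through the proved glue; `sorry` occurs only inside `stub_*`. -/
theorem ContactMeasureLimit_of :
    Summit.AtomisticToContinuum.FouriersLaw.Theses.ContactStieltjesMeasure.ContactMeasureLimit := by
  intro ω₂ lam β hω hl hβ T hT Φ hΦ
  exact tendsto_scaled_of_transforms stub_stieltjesContinuity Φ
    (fun N hN => ⟨(hΦ N hN).1, (hΦ N hN).2.1, (hΦ N hN).2.2.1⟩)
    (stub_stieltjesCauchy ω₂ lam β hω hl hβ T hT Φ hΦ)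

/-- The same composition with the stub STATEMENTS as explicit hypotheses (BC3 reading
`stub₁-sig → stub₂-sig → crux`; sorry-free, kernel-checked, not a named constant). -/
example :
    (∀ ω₂ lam β : ℝ, 0 < ω₂ → 0 < lam → 0 < β → ∀ T : ℝ, 0 < T → ∀ Φ : ℕ → ℝ → ℝ,
      (∀ N : ℕ, 2 ≤ N → Monotone (Φ N) ∧ (∀ s : ℝ, s ≤ 0 → Φ N s = 0) ∧ (∃ m : ℝ, ∀ s : ℝ, Φ N s ≤ m) ∧
        ∀ γ : ℝ, 0 < γ →
          (∀ (N' : ℕ) (T_L T_R : ℝ), 0 < T_L → 0 < T_R →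
            ∀ μ ν : MeasureTheory.Measure (Literature.MathematicalPhysics.KineticTheory.HeatConduction.PhaseSpace N'),
              (Literature.MathematicalPhysics.KineticTheory.HeatConduction.pinnedChain ω₂ lam β γ).IsSteadyState N' T_L T_R μ →
              (Literature.MathematicalPhysics.KineticTheory.HeatConduction.pinnedChain ω₂ lam β γ).IsSteadyState N' T_L T_R ν → μ = ν) →
          ∀ μ : (N' : ℕ) → ℝ → ℝ → MeasureTheory.Measure (Literature.MathematicalPhysics.KineticTheory.HeatConduction.PhaseSpace N'),
            (∀ (N' : ℕ) (T_L T_R : ℝ), 0 < T_L → 0 < T_R →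
              (Literature.MathematicalPhysics.KineticTheory.HeatConduction.pinnedChain ω₂ lam β γ).IsSteadyState N' T_L T_R (μ N' T_L T_R)) →
            Filter.Tendsto (fun δ : ℝ =>
              (Literature.MathematicalPhysics.KineticTheory.HeatConduction.pinnedChain ω₂ lam β γ).totalCurrent
                (μ N (T + δ / 2) (T - δ / 2)) / δ) (nhdsWithin 0 {(0 : ℝ)}ᶜ)
              (nhds (((N : ℝ) - 1) * γ * ∫ t in Set.Ioi (0 : ℝ), Φ N t * (2 * t / (γ ^ 2 + t ^ 2) ^ 2)))) →
      ∀ γ : ℝ, 0 < γ → ∃ L : ℝ,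
        Filter.Tendsto (fun N : ℕ => (N : ℝ) * ∫ t in Set.Ioi (0 : ℝ), Φ N t * (2 * t / (γ ^ 2 + t ^ 2) ^ 2))
          Filter.atTop (nhds L)) →
    (∀ F : ℕ → ℝ → ℝ,
      (∀ N : ℕ, Monotone (F N) ∧ (∀ s : ℝ, s ≤ 0 → F N s = 0) ∧ (∃ m : ℝ, ∀ s : ℝ, F N s ≤ m)) →
      (∀ γ : ℝ, 0 < γ → ∃ L : ℝ,
        Filter.Tendsto (fun N : ℕ => ∫ t in Set.Ioi (0 : ℝ), F N t * (2 * t / (γ ^ 2 + t ^ 2) ^ 2))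
          Filter.atTop (nhds L)) →
      ∃ M : ℝ → ℝ, Monotone M ∧ ∀ t : ℝ, 0 < t → ContinuousAt M t →
        Filter.Tendsto (fun N : ℕ => F N t) Filter.atTop (nhds (M t))) →
    Summit.AtomisticToContinuum.FouriersLaw.Theses.ContactStieltjesMeasure.ContactMeasureLimit := by
  intro hC hS ω₂ lam β hω hl hβ T hT Φ hΦ
  exact tendsto_scaled_of_transforms hS Φ
    (fun N hN => ⟨(hΦ N hN).1, (hΦ N hN).2.1, (hΦ N hN).2.2.1⟩)
    (hC ω₂ lam β hω hl hβ T hT Φ hΦ)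

end Summit.AtomisticToContinuum.FouriersLaw.Cruxes.ContactMeasureLimit.Birth
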